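import Mathlib
import Summits.MatrixMultiplication.Statement
import Summits.MatrixMultiplication.MatrixMultiplication.Theorems.GraphEquationsTwistCancellation
import Summits.MatrixMultiplication.MatrixMultiplication.Theorems.GraphEquationsTangentPrograms
import Summits.MatrixMultiplication.MatrixMultiplication.Theorems.GraphEquationsGapDial

/-!
# Graph equations — THE DEFLATION TOWER, IV: assembly modulo the generic-point supply (M22d, decomp-mm-lens-5 g35)

(supports `MultiplicityReduction`, stmt-MatrixMultiplication-27806.  No new definition.)

This module assembles the three tower kernels — M22a (local algebra), M22b (twist cancellation =
rank reading, `tensorRank_le_of_jetServed`), M22c (cost, `exists_isNonscalarSeq_towerOutputs`) — into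

* `tensorRank_le_of_towerData` — THE TOWER READ-OUT: tests `t_o ∈ ℂ[a,b,c]` free over a nonscalar
  sequence of length `≤ N`; TOWER DATA = a cost-free change of base `θ₀` of `ℂ[a,b,c]`, a list `Ds` of
  `k` derivations of `ℂ[a,b,c,Λ]` with cost-free values on variables (the stages), a finite family of
  sub-words, a cost-free substitution `θ₁` of `ℂ[a,b,c,Λ]` (the shear absorbing value and 1-jet of the
  kernel section), cost-free extra outputs (the normalisers `B_j λ^{(j)} - 1`), the purely quadratic
  2-jet `Q` of the kernel section with the second-order vanishing `hsec`, and constants `P` with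
  `P·[∂_c τ | ∂_Λ τ](0) = [I | 0]` (regularity of the deflated system);  THEN `R(⟨n,n,n⟩) ≤ 2·3^k·N`.
* `familyRung_of_towerSupply` — **FR(m) from the generic-point supply S1(m)**: if for every family
  `t ⊆ I` with `f_q^m ∈ (t)` such tower data with `k + 1 ≤ m` stages EXIST (hypothesis `hS1`, the
  successor target S1 of NODE-g35 §6, stated here verbatim as the binder), then FR(m) holds with
  `C = 2·3^{m-1}` and every `ε > 0`.
* `multiplicityReduction_of_gapHand_of_towerSupply`, `matrixMultiplication_iff_quadratic_gapHand_of_towerSupply`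
  — THE DIAL COLLAPSES ONTO THE HAND given S1(m): `GH(m) ⇒ MultiplicityReduction` and
  `ω = 2 ⟺ V ∧ GH(m)` (M21d `multiplicityReduction_of_gapDial`, `matrixMultiplication_iff_gapDial`).

So after g35 the single statement separating «FR(m) for every m» from the tree is the binder `hS1`
(NODE-g35 §2 Lemma G, (g1)–(g3), Lemma 5 read at a ℂ-generic base: EXISTENCE of the tower data).
No `sorry`.  Sources: NODE-g35 §2; Leykin–Verschelde–Zhao, Theoret. Comput. Sci. 359 (2006) §2–3;
Bürgisser–Clausen–Shokrollahi (1997) (14.8), Prop. 15.1.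
-/

set_option linter.dupNamespace false

namespace Summit.MatrixMultiplication.MatrixMultiplication.Theorems.GraphEquations

open MvPolynomial
open Literature.Computability.AlgebraicComplexity
open Literature.Computability.AlgebraicComplexity.ArithCircuit

variable {n : ℕ}

/-! ## Killing the kernel variables is cost-free -/

/-- The substitution `Λ := 0` (identity on `a,b,c`) maps cost-free elements of `ℂ[a,b,c,Λ]` to
cost-free elements of `ℂ[a,b,c]`. -/
theorem bind₁_killKernel_mem_freeSpan_empty {ι : Type*} {p : MvPolynomial (GraphVars n ⊕ ι) ℂ}
    (hp : p ∈ freeSpan (∅ : Set (MvPolynomial (GraphVars n ⊕ ι) ℂ))) :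
    bind₁ (Sum.elim X (fun _ => 0) : GraphVars n ⊕ ι → MvPolynomial (GraphVars n) ℂ) p ∈
      freeSpan (∅ : Set (MvPolynomial (GraphVars n) ℂ)) := by
  refine apply_mem_of_mem_freeSpan
    ((bind₁ (Sum.elim X (fun _ => 0) : GraphVars n ⊕ ι → MvPolynomial (GraphVars n) ℂ)).toLinearMap)
    ?_ ?_ ?_ hp
  · change bind₁ _ 1 ∈ _
    rw [map_one]
    exact one_mem_freeSpan _
  · intro v
    change bind₁ _ (X v) ∈ _
    rw [bind₁_X_right]
    rcases v with v | i
    · exact X_mem_freeSpan _ v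
    · exact Submodule.zero_mem _
  · intro s hs; simp at hs

/-! ## The tower read-out -/

section ReadOut

variable {ι W κ : Type*} [Fintype ι] [DecidableEq ι] [Fintype W] [DecidableEq W] [Fintype κ]
  [DecidableEq κ]

/-- **THE TOWER READ-OUT** (M22b + M22c): tower data ⇒ `R(⟨n,n,n⟩) ≤ 2·3^k·N`. -/
theorem tensorRank_le_of_towerData {N T : ℕ} (t : Fin T → MvPolynomial (GraphVars n) ℂ)
    (hspan : ∃ gs : List (MvPolynomial (GraphVars n) ℂ), IsNonscalarSeq gs ∧ gs.length ≤ N ∧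
      ∀ o, t o ∈ freeSpan {q | q ∈ gs})
    -- change of base (translation to a point of `W` composed with the graph shear): cost-free
    (θ₀ : GraphVars n → MvPolynomial (GraphVars n) ℂ)
    (hθ₀ : ∀ v, θ₀ v ∈ freeSpan (∅ : Set (MvPolynomial (GraphVars n) ℂ)))
    -- the stages: derivations of `ℂ[a,b,c,Λ]` with cost-free values on the variables
    (Ds : List (Derivation ℂ (MvPolynomial (GraphVars n ⊕ ι) ℂ) (MvPolynomial (GraphVars n ⊕ ι) ℂ)))
    (hDs : ∀ D ∈ Ds, ∀ v, D (X v) ∈ freeSpan (∅ : Set (MvPolynomial (GraphVars n ⊕ ι) ℂ)))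
    (word : W → List (Derivation ℂ (MvPolynomial (GraphVars n ⊕ ι) ℂ) (MvPolynomial (GraphVars n ⊕ ι) ℂ)))
    (hword : ∀ w, (word w).Sublist Ds)
    -- the shear absorbing value and 1-jet of the kernel section: cost-free
    (θ₁ : GraphVars n ⊕ ι → MvPolynomial (GraphVars n ⊕ ι) ℂ)
    (hθ₁ : ∀ v, θ₁ v ∈ freeSpan (∅ : Set (MvPolynomial (GraphVars n ⊕ ι) ℂ)))
    -- the deflated outputs: sheared words of the translated tests, plus cost-free extras
    (τ : (Fin T × W) ⊕ κ → MvPolynomial (GraphVars n ⊕ ι) ℂ)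
    (hτw : ∀ ow : Fin T × W, τ (Sum.inl ow) =
      bind₁ θ₁ ((word ow.2).foldl (fun acc D => D acc)
        (aeval (fun w : GraphVars n => (X (Sum.inl w) : MvPolynomial (GraphVars n ⊕ ι) ℂ))
          (aeval θ₀ (t ow.1)))))
    (hτe : ∀ x : κ, τ (Sum.inr x) ∈ freeSpan (∅ : Set (MvPolynomial (GraphVars n ⊕ ι) ℂ)))
    -- the purely quadratic 2-jet of the kernel section and second-order vanishing along it
    (Q : ι → MvPolynomial (MatMulVars n) ℂ) (hQ0 : ∀ i, coeff 0 (Q i) = 0)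
    (hQ1 : ∀ i (w : MatMulVars n), coeff (Finsupp.single w 1) (Q i) = 0)
    (hsec : ∀ o (i j j' l : Fin n),
      coeff (Finsupp.single (Sum.inl (i, j) : MatMulVars n) 1 +
          Finsupp.single (Sum.inr (j', l) : MatMulVars n) 1)
        (bind₁ (Sum.elim (fun v => graphRestrict n (X v)) Q) (τ o)) = 0)
    -- regularity of the deflated system in `(c, Λ)` at the deflated point
    (P : Fin n × Fin n → (Fin T × W) ⊕ κ → ℂ)
    (hPc : ∀ q q' : Fin n × Fin n,
      ∑ o, P q o * coeff (Finsupp.single (Sum.inl (Sum.inr q') : GraphVars n ⊕ ι) 1) (τ o) =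
        if q = q' then 1 else 0)
    (hPΛ : ∀ (q : Fin n × Fin n) (i' : ι),
      ∑ o, P q o * coeff (Finsupp.single (Sum.inr i' : GraphVars n ⊕ ι) 1) (τ o) = 0) :
    tensorRank (matMulTensor ℂ n n n) ≤ 2 * (3 ^ Ds.length * N) := by
  classical
  refine tensorRank_le_of_jetServed (N' := 3 ^ Ds.length * N) τ ?_ Q hQ0 hQ1 hsec P hPc hPΛ
  -- cost: translate (free), adjoin + words (× 3^k), shear-and-kill (free)
  obtain ⟨gs, hns, hlen, ht⟩ := hspan
  obtain ⟨gs₀, hns₀, hlen₀, hmem₀⟩ := IsNonscalarSeq.exists_aeval_affine θ₀ hθ₀ hns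
  have hθ : ∀ v : GraphVars n ⊕ ι,
      bind₁ (Sum.elim X (fun _ => 0) : GraphVars n ⊕ ι → MvPolynomial (GraphVars n) ℂ) (θ₁ v) ∈
        freeSpan (∅ : Set (MvPolynomial (GraphVars n) ℂ)) := fun v =>
    bind₁_killKernel_mem_freeSpan_empty (hθ₁ v)
  obtain ⟨gs', hns', hlen', hW⟩ := exists_isNonscalarSeq_towerOutputs (fun o => aeval θ₀ (t o))
    ⟨gs₀, hns₀, hlen₀.trans hlen, fun o => hmem₀ (t o) (ht o)⟩ Ds hDs
    (fun v => bind₁ (Sum.elim X (fun _ => 0) : GraphVars n ⊕ ι → MvPolynomial (GraphVars n) ℂ) (θ₁ v))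
    hθ
  refine ⟨gs', hns', hlen', fun o => ?_⟩
  rcases o with ow | x
  · rw [hτw ow, bind₁_bind₁, ← aeval_eq_bind₁]
    exact hW ow.1 _ (hword ow.2)
  · exact freeSpan_mono (Set.empty_subset _) (bind₁_killKernel_mem_freeSpan_empty (hτe x))

end ReadOut

/-! ## FR(m) from the generic-point supply S1(m) -/

/-- **FR(m) ⟸ S1(m).**  The binder `hS1` is the successor target S1 of NODE-g35 verbatim: for every
family `t ⊆ I` free over a nonscalar sequence and with `f_q^m ∈ (t)`, tower data with at most `m - 1`
stages exist (kernel variables `Fin a`, words `Fin b`, extras `Fin c`).  Then FR(m) holds with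
`C = 2·3^{m-1}`. -/
theorem familyRung_of_towerSupply {m : ℕ}
    (hS1 : ∀ n : ℕ, 1 ≤ n → ∀ (N T : ℕ) (t : Fin T → MvPolynomial (GraphVars n) ℂ),
      (∀ o, t o ∈ graphIdeal n) →
      (∃ gs : List (MvPolynomial (GraphVars n) ℂ), IsNonscalarSeq gs ∧ gs.length ≤ N ∧
        ∀ o, t o ∈ freeSpan {q | q ∈ gs}) →
      (∀ q : Fin n × Fin n, generator n q ^ m ∈ Ideal.span (Set.range t)) →
      ∃ (a b c : ℕ) (θ₀ : GraphVars n → MvPolynomial (GraphVars n) ℂ)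
        (Ds : List (Derivation ℂ (MvPolynomial (GraphVars n ⊕ Fin a) ℂ)
          (MvPolynomial (GraphVars n ⊕ Fin a) ℂ)))
        (word : Fin b → List (Derivation ℂ (MvPolynomial (GraphVars n ⊕ Fin a) ℂ)
          (MvPolynomial (GraphVars n ⊕ Fin a) ℂ)))
        (θ₁ : GraphVars n ⊕ Fin a → MvPolynomial (GraphVars n ⊕ Fin a) ℂ)
        (τ : (Fin T × Fin b) ⊕ Fin c → MvPolynomial (GraphVars n ⊕ Fin a) ℂ)
        (Q : Fin a → MvPolynomial (MatMulVars n) ℂ)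
        (P : Fin n × Fin n → (Fin T × Fin b) ⊕ Fin c → ℂ),
        Ds.length + 1 ≤ m ∧
        (∀ v, θ₀ v ∈ freeSpan (∅ : Set (MvPolynomial (GraphVars n) ℂ))) ∧
        (∀ D ∈ Ds, ∀ v, D (X v) ∈ freeSpan (∅ : Set (MvPolynomial (GraphVars n ⊕ Fin a) ℂ))) ∧
        (∀ w, (word w).Sublist Ds) ∧
        (∀ v, θ₁ v ∈ freeSpan (∅ : Set (MvPolynomial (GraphVars n ⊕ Fin a) ℂ))) ∧
        (∀ ow : Fin T × Fin b, τ (Sum.inl ow) =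
          bind₁ θ₁ ((word ow.2).foldl (fun acc D => D acc)
            (aeval (fun w : GraphVars n => (X (Sum.inl w) : MvPolynomial (GraphVars n ⊕ Fin a) ℂ))
              (aeval θ₀ (t ow.1))))) ∧
        (∀ x : Fin c, τ (Sum.inr x) ∈ freeSpan (∅ : Set (MvPolynomial (GraphVars n ⊕ Fin a) ℂ))) ∧
        (∀ i, coeff 0 (Q i) = 0) ∧
        (∀ i (w : MatMulVars n), coeff (Finsupp.single w 1) (Q i) = 0) ∧
        (∀ o (i j j' l : Fin n),
          coeff (Finsupp.single (Sum.inl (i, j) : MatMulVars n) 1 +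
              Finsupp.single (Sum.inr (j', l) : MatMulVars n) 1)
            (bind₁ (Sum.elim (fun v => graphRestrict n (X v)) Q) (τ o)) = 0) ∧
        (∀ q q' : Fin n × Fin n,
          ∑ o, P q o * coeff (Finsupp.single (Sum.inl (Sum.inr q') : GraphVars n ⊕ Fin a) 1) (τ o) =
            if q = q' then 1 else 0) ∧
        (∀ (q : Fin n × Fin n) (i' : Fin a),
          ∑ o, P q o * coeff (Finsupp.single (Sum.inr i' : GraphVars n ⊕ Fin a) 1) (τ o) = 0)) :
    ∀ ε : ℝ, 0 < ε → ∃ C : ℝ, ∀ n : ℕ, 1 ≤ n → ∀ (N T : ℕ) (t : Fin T → MvPolynomial (GraphVars n) ℂ),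
      (∀ o, t o ∈ graphIdeal n) →
      (∃ gs : List (MvPolynomial (GraphVars n) ℂ), IsNonscalarSeq gs ∧ gs.length ≤ N ∧
        ∀ o, t o ∈ freeSpan {q | q ∈ gs}) →
      (∀ q : Fin n × Fin n, generator n q ^ m ∈ Ideal.span (Set.range t)) →
      (tensorRank (matMulTensor ℂ n n n) : ℝ) ≤ C * (n : ℝ) ^ ε * ((N : ℝ) + n * n) := by
  intro ε hε
  refine ⟨2 * 3 ^ (m - 1), fun n hn N T t ht hspan hmem => ?_⟩
  obtain ⟨a, b, c, θ₀, Ds, word, θ₁, τ, Q, P, hk, hθ₀, hDs, hword, hθ₁, hτw, hτe, hQ0, hQ1, hsec,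
    hPc, hPΛ⟩ := hS1 n hn N T t ht hspan hmem
  have hR : tensorRank (matMulTensor ℂ n n n) ≤ 2 * (3 ^ Ds.length * N) :=
    tensorRank_le_of_towerData t hspan θ₀ hθ₀ Ds hDs word hword θ₁ hθ₁ τ hτw hτe Q hQ0 hQ1 hsec
      P hPc hPΛ
  have hpow : 3 ^ Ds.length ≤ 3 ^ (m - 1) := Nat.pow_le_pow_right (by norm_num) (by omega)
  have hR' : tensorRank (matMulTensor ℂ n n n) ≤ 2 * 3 ^ (m - 1) * N := by
    calc tensorRank (matMulTensor ℂ n n n) ≤ 2 * (3 ^ Ds.length * N) := hR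
      _ ≤ 2 * (3 ^ (m - 1) * N) := Nat.mul_le_mul_left _ (Nat.mul_le_mul_right _ hpow)
      _ = 2 * 3 ^ (m - 1) * N := by ring
  have hRr : (tensorRank (matMulTensor ℂ n n n) : ℝ) ≤ 2 * 3 ^ (m - 1) * (N : ℝ) := by
    exact_mod_cast hR'
  have hn1 : (1 : ℝ) ≤ n := by exact_mod_cast hn
  have hε1 : (1 : ℝ) ≤ (n : ℝ) ^ ε := Real.one_le_rpow hn1 hε.le
  have hN : (0 : ℝ) ≤ (N : ℝ) := Nat.cast_nonneg _
  have hK : (0 : ℝ) ≤ 2 * 3 ^ (m - 1) := by positivity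
  calc (tensorRank (matMulTensor ℂ n n n) : ℝ) ≤ 2 * 3 ^ (m - 1) * (N : ℝ) := hRr
    _ ≤ 2 * 3 ^ (m - 1) * ((n : ℝ) ^ ε * ((N : ℝ) + n * n)) := by
        refine mul_le_mul_of_nonneg_left ?_ hK
        calc (N : ℝ) = 1 * N := (one_mul _).symm
          _ ≤ (n : ℝ) ^ ε * ((N : ℝ) + n * n) :=
            mul_le_mul hε1 (by nlinarith [mul_self_nonneg (n : ℝ)]) hN (le_trans zero_le_one hε1)
    _ = 2 * 3 ^ (m - 1) * (n : ℝ) ^ ε * ((N : ℝ) + n * n) := by ring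

/-- **THE DIAL COLLAPSES ONTO THE HAND, given S1(m)**: `GH(m) ⇒ MultiplicityReduction`. -/
theorem multiplicityReduction_of_gapHand_of_towerSupply {m : ℕ}
    (hS1 : ∀ n : ℕ, 1 ≤ n → ∀ (N T : ℕ) (t : Fin T → MvPolynomial (GraphVars n) ℂ),
      (∀ o, t o ∈ graphIdeal n) →
      (∃ gs : List (MvPolynomial (GraphVars n) ℂ), IsNonscalarSeq gs ∧ gs.length ≤ N ∧
        ∀ o, t o ∈ freeSpan {q | q ∈ gs}) →
      (∀ q : Fin n × Fin n, generator n q ^ m ∈ Ideal.span (Set.range t)) →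
      ∃ (a b c : ℕ) (θ₀ : GraphVars n → MvPolynomial (GraphVars n) ℂ)
        (Ds : List (Derivation ℂ (MvPolynomial (GraphVars n ⊕ Fin a) ℂ)
          (MvPolynomial (GraphVars n ⊕ Fin a) ℂ)))
        (word : Fin b → List (Derivation ℂ (MvPolynomial (GraphVars n ⊕ Fin a) ℂ)
          (MvPolynomial (GraphVars n ⊕ Fin a) ℂ)))
        (θ₁ : GraphVars n ⊕ Fin a → MvPolynomial (GraphVars n ⊕ Fin a) ℂ)
        (τ : (Fin T × Fin b) ⊕ Fin c → MvPolynomial (GraphVars n ⊕ Fin a) ℂ)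
        (Q : Fin a → MvPolynomial (MatMulVars n) ℂ)
        (P : Fin n × Fin n → (Fin T × Fin b) ⊕ Fin c → ℂ),
        Ds.length + 1 ≤ m ∧
        (∀ v, θ₀ v ∈ freeSpan (∅ : Set (MvPolynomial (GraphVars n) ℂ))) ∧
        (∀ D ∈ Ds, ∀ v, D (X v) ∈ freeSpan (∅ : Set (MvPolynomial (GraphVars n ⊕ Fin a) ℂ))) ∧
        (∀ w, (word w).Sublist Ds) ∧
        (∀ v, θ₁ v ∈ freeSpan (∅ : Set (MvPolynomial (GraphVars n ⊕ Fin a) ℂ))) ∧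
        (∀ ow : Fin T × Fin b, τ (Sum.inl ow) =
          bind₁ θ₁ ((word ow.2).foldl (fun acc D => D acc)
            (aeval (fun w : GraphVars n => (X (Sum.inl w) : MvPolynomial (GraphVars n ⊕ Fin a) ℂ))
              (aeval θ₀ (t ow.1))))) ∧
        (∀ x : Fin c, τ (Sum.inr x) ∈ freeSpan (∅ : Set (MvPolynomial (GraphVars n ⊕ Fin a) ℂ))) ∧
        (∀ i, coeff 0 (Q i) = 0) ∧
        (∀ i (w : MatMulVars n), coeff (Finsupp.single w 1) (Q i) = 0) ∧
        (∀ o (i j j' l : Fin n),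
          coeff (Finsupp.single (Sum.inl (i, j) : MatMulVars n) 1 +
              Finsupp.single (Sum.inr (j', l) : MatMulVars n) 1)
            (bind₁ (Sum.elim (fun v => graphRestrict n (X v)) Q) (τ o)) = 0) ∧
        (∀ q q' : Fin n × Fin n,
          ∑ o, P q o * coeff (Finsupp.single (Sum.inl (Sum.inr q') : GraphVars n ⊕ Fin a) 1) (τ o) =
            if q = q' then 1 else 0) ∧
        (∀ (q : Fin n × Fin n) (i' : Fin a),
          ∑ o, P q o * coeff (Finsupp.single (Sum.inr i' : GraphVars n ⊕ Fin a) 1) (τ o) = 0))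
    (hH : ∀ β : ℝ, 2 ≤ β → EqAdmissible β → ∀ β' : ℝ, β < β' →
      ∃ c : ℝ, ∀ n : ℕ, 1 ≤ n → ∃ (E : EqSystem n) (k : ℕ), E.Correct ∧
        (∀ j ∈ E.tests, E.testPoly j ∈ graphIdeal n ^ (k + 1)) ∧
        (∀ q : Fin n × Fin n, generator n q ^ (k + m) ∈
          Ideal.span (Set.range fun o : Fin E.tests.length => E.testPoly (E.tests.get o))) ∧
        ((k + 2).choose 2 : ℝ) * (E.cost : ℝ) ≤ c * (n : ℝ) ^ β') :
    MultiplicityReduction :=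
  multiplicityReduction_of_gapDial (familyRung_of_towerSupply hS1) hH

end Summit.MatrixMultiplication.MatrixMultiplication.Theorems.GraphEquations
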